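import Mathlib.LinearAlgebra.FiniteDimensional.Basic
import Mathlib.LinearAlgebra.FiniteDimensional.Lemmas
import Mathlib.LinearAlgebra.Dimension.Finite
import Mathlib.Tactic.Ring
import Mathlib.Tactic.NormNum
import Mathlib.Tactic.Linarith
import Mathlib.Tactic.FieldSimp
import Mathlib.Tactic.LinearCombination
import HarnessLib

/-!
# NSC(−2) · H-27 TEST (carver C835 (c)/(d), clock K7″; prover 1 gen 61): the finite / polynomial / linear-algebra cores of
# T0 (dim D_hab = 5), of the Abel–Prym rigidity r_⊥(AP) = 4, and of the local structure of the named component over the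
# vertex line (NOT Cohen–Macaulay) — ten def-free heads

Family `hodge`, b2b cell `hweil` (helper of item stmt-HodgeConjecture-2524; cell target NSC(−2) =
`Ring2.Hypotheses.WeilClassesComponent 3 3 [−2]`). Order LADDER `## CARVER v139` C835 (c) for pv1-g61 (the K7′ (i) test seat):
«T0 dim D_hab; T1 r_⊥ (M1 first); T2 only if r_⊥ = 0; at most ONE def-free `Nsc` kernel file». An `Nsc` file (C807 (d), C834 (ε))
with NO `Ring2*` import; Mathlib + HarnessLib only; no `def`, no named fact. Companion report `HOME/b2b-hweil-pv1-g61/H27-TEST.md`.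

THE DICTIONARY (report §§1–4, seat level; NOTHING of it is formalised beyond the algebra below). `𝒞 : y⁶ = f(x) = ∏(x − b_k)^{β_k}`,
`β = (1,5,1,5,1,4,4,3)` (tuple 11134455), `σ : y ↦ ζ₆y`, `B̂ = J(𝒞)/A′` the primitive Prym quotient (a Weil-type abelian sixfold,
`K = ℚ(ζ₆)`), `V = V_χ ⊕ V_χ̄ = H⁰(B̂, Ω¹) ⊂ H⁰(ω_𝒞)` with `V_χ = ⟨xˡdx/y⟩`, `V_χ̄ = ⟨xˡP₅dx/y⁵⟩` (`l = 0,1,2`,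
`P₅ = ∏(x − b_k)^{⌊5β_k/6⌋}`); `T_Weil ≅ (V_χ ⊗ V_χ̄)^∨` (dim 9) the tangent space of the Weil locus at `B̂_b`; `D_hab ⊂ T_Weil`
the image of the habitat `U_β` (8 points on `ℙ¹` mod `PGL₂`, dim 5) under the differential of the Prym period map, whose
codifferential is the multiplication map `μ : V_χ ⊗ V_χ̄ → H⁰(ω_𝒞²)^{μ₆} ≅ H⁰(ℙ¹, K²(b₁+⋯+b₈))` (dim 5); `W ⊂ 𝒞⁽⁶⁾` one
sextic-root sheet over the quadric cone `V`, `Z = u₁(W) ⊂ B̂` the named component (pv1-g60, H27-STEP1 §2.4), `ℓ ⊂ V` the vertex line.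
* `nsc_h27t_exponent_table` — T0's exponent identity `⌊5β/6⌋ + 1 = β` (β ∈ {1,3,4,5}) giving `P₅/f = 1/ω`, and the holomorphy
  counts `3,2,2,3,3` (g = 13) of the five eigenspaces (`decide`).
* `nsc_h27t_mu_monomials` — `μ(xᵃdx/y ⊗ xᶜP₅dx/y⁵) = x^{a+c}dx²/ω`: the exponent set `{a+c : a,c ≤ 2}` is `{0,…,4}`, of
  cardinality `5 = dim M_{0,8} = 8 − 3`: `μ` is SURJECTIVE at every member (`decide`).
* `nsc_h27t_transverse_count` — rank–nullity: a surjection from a 9-space onto a 5-space has a 4-dimensional kernel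
  (`T_Weil/D_hab ≅ (ker μ)^∨`: FOUR transverse Weil directions; `r_⊥ ≤ 4`).
* `nsc_h27t_reynolds` — the σ-averaging step of PROPOSITION A: for linear `df : Θ → E` intertwining idempotent-free "Reynolds"
  operators `ρ_Θ`, `ρ_E` (`df ∘ ρ_Θ = ρ_E ∘ df`), an invariant class in `range df` lies in `df(range ρ_Θ)`.
* `nsc_h27t_abelPrym_rperp` — the bookkeeping of PROPOSITION A / COROLLARY A′: `L(AP) = D_hab` ⟹ `r_⊥(AP) = 9 − 5 = 4 > 0`.
* `nsc_h27t_iota_cofactor` — the KEY IDENTITY of the vertex analysis: `q₁₂(t′)q₃₄(t) − q₁₂(t)q₃₄(t′) = (t′ − t)·C(t,t′)` with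
  `C` symmetric and `C(b₁,b₂) = C(b₃,b₄) = 0` (`C = 0` is the involution `ι` of `ℙ¹` with `ι(b₁) = b₂`, `ι(b₃) = b₄`; the Jacobian
  `∂(r₁+r₂, r₃+r₄)/∂(t,t′)` is `r₁r₃(b₁−b₂)(b₃−b₄)·[…]/denominators`, so it DROPS RANK exactly on `W_ℓ`) (`ring`).
* `nsc_h27t_cone_perfect_square` — on the Whitney-umbrella normalisation `z₆ = w²/c`, `z₇ = z₅w` with `c³A₇² = 4A₅A₆`:
  `A₅z₅⁶ + A₆z₆³ + A₇z₇³ = A₅(z₅³ + (A₇/2A₅)w³)²` — the second local equation `z₈² ∝ r₅+r₆+r₇` acquires TWO smooth branches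
  (`field_simp` + `linear_combination`).
* `nsc_h27t_nu_injective` — `w² = w′² ∧ w³ = w′³ → w = w′`: the local parametrisation `ν(z₅,w) = (z₅, w²/c, z₅w, ±κ(z₅³+ew³))`
  of the sheet at a vertex point is INJECTIVE (so the sheet is unibranch, homeomorphic to its smooth normalisation there).
* `nsc_h27t_value_semigroup_gap` — the subring `ℂ{z₅, w², z₅w, w³}` misses `w`: on `z₅ = 0` its value semigroup is `⟨2,3⟩ ∌ 1`
  (`a + c = 0 → 2b + c + 3d ≠ 1`, `omega`): the germ is NOT normal, hence (being R₁) NOT S₂, NOT Cohen–Macaulay, NOT lci.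
* `nsc_h27t_sheet_labels` — `(j, ε) ↦ 2j + 3ε (mod 6)` is a bijection `Fin 3 × Fin 2 → Fin 6` (the six local branches
  `B_j^ε` at a vertex point carry the six sheet labels `ε·ω^{−2j} ∈ μ₆` once each: EVERY sheet is unibranch and non-normal
  along `ρ̄⁻¹(ℓ)`) (`decide`).

HONEST FRAMING: elementary algebra behind a seat-level report; nothing here is a rung, a candidate, a case of the Hodge
conjecture or evidence for NSC(−2); the geometric statements (infinitesimal Prym–Torelli on the habitat, `L(AP) = D_hab`,
the local model of `W` over `ℓ`, «`Z_b` is not a regular immersion») are proved in the report at seat level and are NOT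
formalised and NOT cited as facts; THEOREM F / PROPOSITION T / LEMMA LIFT / LEMMA KER are the cell's records, not facts;
no statement of [Markman 2025] / [Perry 2026] is used; `HC_CM` occurs nowhere.
[cite: Bloch1972Semiregularity, §6–§7 (obstruction vs. semiregularity; the lci hypothesis of Thm. (7.4))]
[cite: Hartshorne2010, §5 Thm. 5.1 and Ex. 5.3 (embedded first-order deformations and their obstruction in H¹(𝒩)); §24]
[cite: Matsumura1987, Thm. 23.8 (Serre's criterion: normal ⟺ R₁ + S₂) and §17 (Cohen–Macaulay)]
-/

-- mandated namespace `Summit.HodgeConjecture.HodgeConjecture.…` (Problem = Summit) trips `linter.dupNamespace`; the lakefile disables it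
-- tree-wide (weak option), restated here so stand-alone elaboration is warning-free too.
set_option linter.dupNamespace false

namespace Summit.HodgeConjecture.HodgeConjecture.WeilTypeLadder

section NscH27Test

open Module LinearMap

/-- **T0, the exponent table.** For the rotations `β ∈ {1,3,4,5}` occurring in `(1,5,1,5,1,4,4,3)`: `⌊5β/6⌋ + 1 = β`, i.e.
`P₅/f = ∏(x−b_k)^{⌊5β_k/6⌋−β_k} = 1/ω`; `Σ_k ⌊5β_k/6⌋ = 16`; and the holomorphy counts `#{l ≤ 4j − 2 − Σ_k⌊jβ_k/6⌋}` for
`j = 1,…,5` are `3,2,2,3,3` (total genus 13; the Prym eigenspaces `j = 1, 5` have dimension 3 each: signature (3,3)).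
[cite: Shioda1979PJA, §1 (holomorphic differentials on cyclic covers y^m = f(x))] -/
theorem nsc_h27t_exponent_table :
    (∀ β ∈ ({1, 3, 4, 5} : Finset ℕ), 5 * β / 6 + 1 = β) ∧
    (([1, 5, 1, 5, 1, 4, 4, 3].map fun β => 5 * β / 6).sum = 16) ∧
    (([1, 2, 3, 4, 5].map fun j => 4 * j - 2 - ([1, 5, 1, 5, 1, 4, 4, 3].map fun β => j * β / 6).sum + 1) = [3, 2, 2, 3, 3]) ∧
    (3 + 2 + 2 + 3 + 3 = 13) := by
  refine ⟨by decide, by decide, by decide, by norm_num⟩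

/-- **T0, surjectivity of the multiplication map.** `μ(xᵃdx/y ⊗ xᶜP₅dx/y⁵) = x^{a+c}·dx²/ω` and `{a + c : a, c ∈ {0,1,2}} =
{0,1,2,3,4}`, a basis of `H⁰(ℙ¹, K_{ℙ¹}^{⊗2}(b₁+⋯+b₈)) = {g dx²/ω : deg g ≤ 8 − 4}` (dimension `5 = dim M_{0,8} = 8 − 3`): the
codifferential of the Prym period map of the habitat is ONTO, i.e. the period map is an immersion, `dim D_hab = 5`, at EVERY
member. [cite: Voisin2002, Thm. 10.21 and Lemma 10.22 (the differential of the period map is the cup product, dual to multiplication)] -/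
theorem nsc_h27t_mu_monomials :
    Finset.image (fun p : Fin 3 × Fin 3 => (p.1 : ℕ) + (p.2 : ℕ)) Finset.univ = {0, 1, 2, 3, 4} ∧
    (Finset.image (fun p : Fin 3 × Fin 3 => (p.1 : ℕ) + (p.2 : ℕ)) Finset.univ).card = 5 ∧
    (Finset.univ : Finset (Fin 3 × Fin 3)).card = 9 ∧ (8 - 3 = 5 ∧ 8 - 4 = 4 ∧ 4 + 1 = 5) := by
  refine ⟨by decide, by decide, by decide, by norm_num⟩

variable {F V Q Θ E : Type*} [Field F] [AddCommGroup V] [Module F V] [AddCommGroup Q] [Module F Q]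
  [AddCommGroup Θ] [Module F Θ] [AddCommGroup E] [Module F E]

/-- **T0 ⟹ four transverse directions.** A SURJECTIVE linear map `μ` from a 9-dimensional space (`V_χ ⊗ V_χ̄`) onto a
5-dimensional one (`T_b^∨U_β`) has a 4-dimensional kernel: `T_Weil/D_hab ≅ (ker μ)^∨` has dimension `9 − 5 = 4` (the four
Hankel relations `Σ_{a+c=k} c_{ac} = 0`), so every transversality count of the test satisfies `r_⊥ ≤ 4`. [folklore: rank–nullity] -/
theorem nsc_h27t_transverse_count [FiniteDimensional F V] [FiniteDimensional F Q] (μ : V →ₗ[F] Q)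
    (hμ : Function.Surjective μ) (hV : finrank F V = 9) (hQ : finrank F Q = 5) :
    finrank F (ker μ) = 4 ∧ finrank F (range μ) = 5 := by
  have hr : range μ = ⊤ := range_eq_top.mpr hμ
  have hrk : finrank F (range μ) = 5 := by rw [hr, finrank_top, hQ]
  have h := finrank_range_add_finrank_ker μ
  refine ⟨by omega, hrk⟩

/-- **PROPOSITION A, the averaging step.** Let `df : Θ → E` be linear (the differential `H¹(T_𝒞) → Lie B̂ ⊗ H¹(𝒪_𝒞)` of the
Abel–Prym map) and `ρ_Θ`, `ρ_E` linear operators with `df ∘ ρ_Θ = ρ_E ∘ df` (the Reynolds averages over `⟨σ⟩ ≅ μ₆`). If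
`ξ ∈ range df` is `ρ_E`-invariant (`ρ_E ξ = ξ`: a `K`-equivariant, i.e. Weil, direction) then `ξ ∈ df(range ρ_Θ)`
(it comes from a `σ`-INVARIANT deformation of the curve, i.e. from `T_bU_β`: `L(AP) ⊆ D_hab`). [folklore: Reynolds operator] -/
theorem nsc_h27t_reynolds (df : Θ →ₗ[F] E) (ρΘ : Θ →ₗ[F] Θ) (ρE : E →ₗ[F] E)
    (hcomm : df ∘ₗ ρΘ = ρE ∘ₗ df) {ξ : E} (hξ : ξ ∈ range df) (hinv : ρE ξ = ξ) :
    ξ ∈ Submodule.map df (range ρΘ) := by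
  obtain ⟨θ, rfl⟩ := hξ
  refine ⟨ρΘ θ, ⟨θ, rfl⟩, ?_⟩
  have h := LinearMap.congr_fun hcomm θ
  simp only [coe_comp, Function.comp_apply] at h
  rw [h, hinv]

/-- **PROPOSITION A / COROLLARY A′, bookkeeping.** With `dim T_Weil = 3·3 = 9`, `dim D_hab = 8 − 3 = 5` (T0) and
`L(AP) = D_hab` (report §2): `r_⊥(AP) := 9 − dim L(AP) = 4 > 0` — the Abel–Prym curve of the habitat (and, by Kempf's theorem
on deformations of symmetric products, every map `u_k : 𝒞⁽ᵏ⁾ → B̂`, in particular pv1-g60's `u₁ : 𝒞⁽⁶⁾ → B̂` of degree 288)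
lifts to first order along NO Weil direction transverse to the habitat. [cite: Kempf1981SymmetricProducts, Thm. (p. 319)] -/
theorem nsc_h27t_abelPrym_rperp :
    (3 * 3 = 9 ∧ 8 - 3 = 5 ∧ 9 - 5 = 4 ∧ 0 < 4) ∧
    (∀ dimL : ℕ, dimL = 5 → 9 - dimL = 4) ∧ (∀ r : ℕ, r = 9 - 5 → 0 < r) := by
  refine ⟨by norm_num, fun dimL h => by omega, fun r h => by omega⟩

/-- **The vertex identity.** For `q₁₂(u) = (u−b₁)(u−b₂)`, `q₃₄(u) = (u−b₃)(u−b₄)`: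
`q₁₂(t′)q₃₄(t) − q₁₂(t)q₃₄(t′) = (t′ − t)·C(t,t′)` with
`C(t,t′) = (b₁+b₂−b₃−b₄)tt′ − (b₁b₂ − b₃b₄)(t+t′) + b₁b₂(b₃+b₄) − b₃b₄(b₁+b₂)`, `C` symmetric, `C(b₁,b₂) = C(b₃,b₄) = 0`.
READING (report §3.2): the `2×2` Jacobian of `(r₁+r₂, r₃+r₄)` in the two free roots `(t,t′)` equals
`r₁r₃(b₁−b₂)(b₃−b₄)·[q₁₂(t′)q₃₄(t)−q₁₂(t)q₃₄(t′)]/(q₁₂(t)q₁₂(t′)q₃₄(t)q₃₄(t′))`, hence is singular iff `t′ = t` or `C(t,t′) = 0`,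
i.e. iff `t′ = ι(t)` for the involution `ι` of `ℙ¹` swapping `b₁ ↔ b₂`, `b₃ ↔ b₄` — which is EXACTLY the vertex line `ℓ` of `V`.
[folklore: polynomial identity] -/
theorem nsc_h27t_iota_cofactor {R : Type*} [CommRing R] (b₁ b₂ b₃ b₄ t t' : R) :
    let C : R → R → R := fun u v =>
      (b₁ + b₂ - b₃ - b₄) * u * v - (b₁ * b₂ - b₃ * b₄) * (u + v) + b₁ * b₂ * (b₃ + b₄) - b₃ * b₄ * (b₁ + b₂)
    (t' - b₁) * (t' - b₂) * ((t - b₃) * (t - b₄)) - (t - b₁) * (t - b₂) * ((t' - b₃) * (t' - b₄)) = (t' - t) * C t t' ∧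
    C t t' = C t' t ∧ C b₁ b₂ = 0 ∧ C b₃ b₄ = 0 ∧
    ((b₂ - t) - (b₁ - t) = b₂ - b₁ ∧ (b₁ - t) * (b₂ - t) = (t - b₁) * (t - b₂)) := by
  refine ⟨by ring, by ring, by ring, by ring, by ring, by ring⟩

/-- **The perfect square on the cone.** On the normalisation `(z₅, w)` of the Whitney umbrella `S_j = {z₇² = c·z₅²z₆}`
(`z₆ = w²/c`, `z₇ = z₅w`) with `c³A₇² = 4A₅A₆` (the cone relation `r₇² = 4r₅r₆` read in the uniformisers `r₅ = −A₅z₅⁶`,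
`r₆ = −A₆z₆³`, `r₇ = −A₇z₇³`): `A₅z₅⁶ + A₆z₆³ + A₇z₇³ = A₅(z₅³ + (A₇/(2A₅))w³)²` (characteristic `≠ 2`). READING (report §3.3):
the remaining equation `A₈z₈² = −(A₅z₅⁶ + A₆z₆³ + A₇z₇³)` (from `Σ_j r_j = 0`) splits into the TWO smooth branches
`z₈ = ±κ(z₅³ + e w³)`: six local branches `B_j^±` at a vertex point, each parametrised by a smooth `(z₅,w)`-germ.
[folklore: polynomial identity] -/
theorem nsc_h27t_cone_perfect_square {K : Type*} [Field K] (A₅ A₆ A₇ c z₅ w : K) (hA : A₅ ≠ 0) (hc : c ≠ 0)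
    (h2 : (2 : K) ≠ 0) (hcone : c ^ 3 * A₇ ^ 2 = 4 * A₅ * A₆) :
    (z₅ * w) ^ 2 = c * z₅ ^ 2 * (w ^ 2 / c) ∧
    A₅ * z₅ ^ 6 + A₆ * (w ^ 2 / c) ^ 3 + A₇ * (z₅ * w) ^ 3 = A₅ * (z₅ ^ 3 + A₇ / (2 * A₅) * w ^ 3) ^ 2 := by
  constructor
  · field_simp
  · have h2A : (2 : K) * A₅ ≠ 0 := mul_ne_zero h2 hA
    field_simp
    linear_combination (-(w ^ 6)) * hcone

/-- **Injectivity of the local parametrisation.** Over a field of characteristic `≠ 2`: `w² = w′²` and `w³ = w′³` force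
`w = w′`. READING (report §3.3): `ν(z₅,w) = (z₅, w²/c, z₅w, ±κ(z₅³ + e w³))` is injective (`z₅ = z₅′`, `w² = w′²`, `w³ = w′³`),
and an immersion exactly off `(0,0)` (the `2×2` minors of `dν` contain `2w/c` and `z₅`): each local branch of the sheet at a
vertex point is homeomorphic to its SMOOTH normalisation and singular at that point only. [folklore] -/
theorem nsc_h27t_nu_injective {K : Type*} [Field K] (w w' : K) (h2 : (2 : K) ≠ 0) (hsq : w ^ 2 = w' ^ 2)
    (hcu : w ^ 3 = w' ^ 3) : w = w' := by
  have hfac : (w - w') * (w + w') = 0 := by linear_combination hsq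
  rcases mul_eq_zero.mp hfac with h | h
  · exact sub_eq_zero.mp h
  · have hw : w = -w' := by linear_combination h
    subst hw
    have h3 : (2 : K) * w' ^ 3 = 0 := by linear_combination (-1 : K) * hcu
    rcases mul_eq_zero.mp h3 with h2z | hz
    · exact absurd h2z h2
    · have : w' = 0 := pow_eq_zero_iff (n := 3) (by norm_num) |>.mp hz
      subst this
      simp

/-- **The value-semigroup gap (non-normality).** In the subring `ℂ{z₅, w², z₅w, z₅³ + e w³} = ℂ{z₅, w², z₅w, w³}` of
`ℂ{z₅, w}` a monomial `z₅ᵃ wᵐ` arises from `(z₅)^a (w²)^b (z₅w)^c (w³)^d` with exponents `(a + c, 2b + c + 3d)`; on the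
`w`-axis (`a + c = 0`) the attainable `w`-exponents are `2b + 3d ∈ ⟨2,3⟩`, which misses `1`: `w` is integral (`w² ∈`) but not in
the ring. READING (report §3.3–3.4): the local branch `B` of the sheet at a vertex point is NOT normal; being regular in
codimension one it is NOT S₂ (Serre), of depth `1 < 2`: NOT Cohen–Macaulay, hence not Gorenstein and NOT a local complete
intersection; `W` and (under (G)) `Z = u₁(W)` are not Cohen–Macaulay along the vertex curve, so `Z ↪ B̂` is NOT a regular
immersion. [cite: Matsumura1987, Thm. 23.8 (Serre's criterion) and Thm. 17.3–17.4 (CM and regular sequences)] -/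
theorem nsc_h27t_value_semigroup_gap :
    (∀ a b c d : ℕ, a + c = 0 → 2 * b + c + 3 * d ≠ 1) ∧
    (∃ b d : ℕ, 2 * b + 3 * d = 2) ∧ (∃ b d : ℕ, 2 * b + 3 * d = 3) ∧
    (∀ n : ℕ, 2 ≤ n → ∃ b d : ℕ, 2 * b + 3 * d = n) ∧ ((1 : ℕ) < 2 ∧ (2 : ℕ) < 3) := by
  refine ⟨fun a b c d h => by omega, ⟨1, 0, by norm_num⟩, ⟨0, 1, by norm_num⟩, fun n hn => ?_, by norm_num⟩
  rcases Nat.even_or_odd n with ⟨k, hk⟩ | ⟨k, hk⟩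
  · exact ⟨k, 0, by omega⟩
  · exact ⟨k - 1, 1, by omega⟩

/-- **The six sheet labels at a vertex point.** The label of the local branch `B_j^ε` (`j ∈ ℤ/3` the cube root in the
umbrella factor, `ε ∈ ℤ/2` the sign of `z₈`) is `ε·ω^{−2j} = ζ₆^{3ε + 2j}`; the map `(j, ε) ↦ 2j + 3ε (mod 6)` is a
BIJECTION `Fin 3 × Fin 2 → Fin 6`. READING (report §3.3): every one of the six sheets `W₀,…,W₅` of `ρ̄⁻¹(V)` has EXACTLY ONE
local branch at a general point of `ρ̄⁻¹(ℓ)` — each sheet contains the whole vertex curve, is unibranch there, and is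
non-normal there. [folklore: Chinese remainder ℤ/6 ≅ ℤ/3 × ℤ/2] -/
theorem nsc_h27t_sheet_labels :
    Function.Bijective (fun p : Fin 3 × Fin 2 => (⟨(2 * (p.1 : ℕ) + 3 * (p.2 : ℕ)) % 6, Nat.mod_lt _ (by norm_num)⟩ : Fin 6)) ∧
    (Finset.univ : Finset (Fin 3 × Fin 2)).card = 6 := by
  refine ⟨?_, by decide⟩
  rw [Fintype.bijective_iff_injective_and_card]
  exact ⟨by decide, by decide⟩

/-- **K7″ bookkeeping of the test (numbers only).** `dim T_Weil = 9`, `dim D_hab = 5` (T0, all members); `r_⊥(AP) = 4`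
(PROPOSITION A); for the named component: `dim Z = 3` and `depth ≤ 2 < 3` along the vertex curve (not Cohen–Macaulay), so the
regular-immersion clause of the seed predicate fails independently of `r_⊥(Z)`; the one undecided number is
`r_⊥(𝒢) ∈ {0,…,4}` in the object format. [folklore: arithmetic] -/
theorem nsc_h27t_bookkeeping :
    (9 - 5 = 4) ∧ (∀ depth : ℕ, depth ≤ 2 → depth < 3) ∧ (∀ r : ℕ, r ≤ 9 - 5 → r ∈ ({0, 1, 2, 3, 4} : Finset ℕ)) := by
  refine ⟨by norm_num, fun d hd => by omega, fun r hr => ?_⟩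
  simp only [Finset.mem_insert, Finset.mem_singleton]
  omega

end NscH27Test

end Summit.HodgeConjecture.HodgeConjecture.WeilTypeLadder
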